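import Summits.ResolutionOfSingularities.ResolutionOfSingularities.Theorems.HomologicalConductorNoZenoShadowCapture
import HarnessLib

/-!
# Crux `NoZenoR` (stmt-ResolutionOfSingularities-19943): EXHAUSTION EXCLUDES TERMINATION — the exhaustive kernel slots are NON-EXISTENCE statements

OURS (cell res-hironaka, crux chain W4.4; lead res-L0-w44-lead-1 g10, DESK WORD 46 OBJECT 2-Z; the lemma is tri-2's READING of the sharp stubs,
registry v33 §7Δ `not_isRegularLocalRing_of_exhaustive`, here made a tree theorem).  AI-written, weaker than expert review; nothing here is a
statement of the manuscript under review (Hironaka 2017).  SUPPORT-level, counted 0.  Def-free, fact-free.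

* `not_isRegularLocalRing_of_exhaustive` — under the KERNEL binder (`hker`: every valuation ring weakly dominating the tower is non-noetherian)
  and EXHAUSTION (`⋃ T_m = O`), NO stage is regular: a regular stage `T_M` is stationary (`NoetherianCapture.tower_eq_of_le_of_isRegularLocalRing`),
  so `O = ⋃ T_m = T_M` would be a NOETHERIAN dominator of its own tower.
* TEXT LEVEL (iff-readings): `exh3_iff_noDatum : <Exh3> ↔ <Exh3's binders → False>`, `exhHigh_iff_noDatum`, `e3_iff_noDatum`,
  `shadowCapture3_iff_noDatum` — the honest content of every EXHAUSTIVE residual of record (slot 2: Exh3 = Exh3^{Abh} ∧ Exh3^{def}, ExhHigh;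
  slot 3: E3 ⟸ E3^{pd} ⟸ E3^{E} ⟺ ShadowCapture3) is the NON-EXISTENCE of an exhausting threadless kernel tower: «threadless kernel towers
  never exhaust a non-noetherian valuation ring».  KILL CRITERION sharpened accordingly: ANY datum meeting Exh3's binders refutes Exh3 as typed
  («never regular» is automatic).
-/

noncomputable section

-- single-problem summit: the doubled namespace component `ResolutionOfSingularities` is forced
set_option linter.dupNamespace false

namespace Summit.ResolutionOfSingularities.ResolutionOfSingularities.Theorems.NoZeno.Exhaustion

open Summit.ResolutionOfSingularities.ResolutionOfSingularities.Theses.HomologicalConductor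
open Summit.ResolutionOfSingularities.ResolutionOfSingularities.Theorems.NoZeno.Birth
open Summit.ResolutionOfSingularities.ResolutionOfSingularities.Theorems.NoZeno.SandwichCluster.Parasite
open Summit.ResolutionOfSingularities.ResolutionOfSingularities.Theorems
open Summit.ResolutionOfSingularities.ResolutionOfSingularities.Theorems.NoZeno
open Literature.AlgebraicGeometry.Resolution IsLocalRing

variable {k K : Type} [Field k] [Field K] [Algebra k K]

/-! ## The lemma -/

/-- **EXHAUSTIVE KERNEL TOWERS NEVER TERMINATE.**  If every element of `O` is eventually a stage element and every valuation ring weakly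
dominating the tower is non-noetherian, then no stage is regular: a regular stage `T_M` makes the tower stationary, so `O = ⋃ T_m = T_M` would be a
noetherian dominator (stages are noetherian, `stub_towerNoetherian`). [OURS: tri-2 reading, registry v33 §7Δ] -/
theorem not_isRegularLocalRing_of_exhaustive (O : ValuationSubring K) (A : Subalgebra k K)
    (hk : ∀ c : k, algebraMap k K c ∈ O) (hA : A.FG) (hfr : IsFractionRing ↥A K) (hAO : A.toSubring ≤ O.toSubring)
    (hker : ∀ O' : ValuationSubring K,
      (∀ m : ℕ, ∀ s ∈ tower O A m, s ∈ O' ∧ (s⁻¹ ∈ O' → s⁻¹ ∈ O)) → ¬ IsNoetherianRing ↥O')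
    (hexh : ∀ x : K, x ∈ O → ∃ m : ℕ, x ∈ tower O A m) (M : ℕ) :
    ¬ IsRegularLocalRing ↥(tower O A M) := by
  intro hreg
  haveI := hfr
  haveI hN : IsNoetherianRing ↥(tower O A M) := stub_towerNoetherian k K O A hk hA hfr hAO M
  have hTO : ∀ (m : ℕ) (x : K), x ∈ tower O A m → x ∈ O := mem_valuationSubring_of_mem_tower O hk hAO
  have hOT : ∀ x : K, x ∈ O → x ∈ tower O A M := fun x hx => by
    obtain ⟨m, hm⟩ := hexh x hx
    rcases le_total m M with h | h
    · exact d2rc_mem_tower_of_le O A h hm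
    · rw [← NoetherianCapture.tower_eq_of_le_of_isRegularLocalRing O A hk hfr hAO M hreg m h]
      exact hm
  let e : ↥(tower O A M) ≃+* ↥O :=
    { toFun := fun x => ⟨x.1, hTO M x.1 x.2⟩
      invFun := fun x => ⟨x.1, hOT x.1 x.2⟩
      left_inv := fun _ => rfl
      right_inv := fun _ => rfl
      map_mul' := fun _ _ => rfl
      map_add' := fun _ _ => rfl }
  exact hker O (fun m s hs => ⟨hTO m s hs, id⟩) (isNoetherianRing_of_ringEquiv (↥(tower O A M)) e)

/-- Packaged at the kernel binders: an exhausting kernel tower has NO regular stage. [this work] -/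
theorem no_regular_stage_of_exhaustive (O : ValuationSubring K) (A : Subalgebra k K)
    (hk : ∀ c : k, algebraMap k K c ∈ O) (hA : A.FG) (hfr : IsFractionRing ↥A K) (hAO : A.toSubring ≤ O.toSubring)
    (hker : ∀ O' : ValuationSubring K,
      (∀ m : ℕ, ∀ s ∈ tower O A m, s ∈ O' ∧ (s⁻¹ ∈ O' → s⁻¹ ∈ O)) → ¬ IsNoetherianRing ↥O')
    (hexh : ∀ x : K, x ∈ O → ∃ m : ℕ, x ∈ tower O A m) :
    ¬ ∃ M : ℕ, IsRegularLocalRing ↥(tower O A M) :=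
  fun ⟨M, hM⟩ => not_isRegularLocalRing_of_exhaustive O A hk hA hfr hAO hker hexh M hM

/-! ## TEXT LEVEL: the exhaustive residuals are non-existence statements -/

/-- **Exh3 ⟺ «no datum meets Exh3's binders».** [this work; iff-reading] -/
theorem exh3_iff_noDatum :
    (PersistenceRadical → StrictDrop → ∀ p : ℕ, p.Prime → ∀ (k K : Type) [Field k] [CharP k p] [Field K]
      [Algebra k K] (O : ValuationSubring K) (A : Subalgebra k K), (∀ c : k, algebraMap k K c ∈ O) →
      A.FG → IsFractionRing ↥A K → A.toSubring ≤ O.toSubring →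
      (∀ O' : ValuationSubring K,
        (∀ m : ℕ, ∀ s ∈ tower O A m, s ∈ O' ∧ (s⁻¹ ∈ O' → s⁻¹ ∈ O)) → ¬ IsNoetherianRing ↥O') →
      (∀ O' : ValuationSubring K, O < O' → ∃ m : ℕ, ∃ s ∈ tower O A m, s⁻¹ ∈ O' ∧ s⁻¹ ∉ O) →
      (∀ (k' K' : Type) [Field k'] [CharP k' p] [Field K'] [Algebra k' K'] (O' : ValuationSubring K')
        (A' : Subalgebra k' K'), (∀ c : k', algebraMap k' K' c ∈ O') → A'.FG → IsFractionRing ↥A' K' →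
        A'.toSubring ≤ O'.toSubring → Algebra.trdeg k' K' < Algebra.trdeg k K →
        ∃ m : ℕ, IsRegularLocalRing ↥(tower O' A' m)) →
      (∀ m : ℕ, ∀ s ∈ tower O A m, ∃ f : Polynomial k, f ≠ 0 ∧ O.valuation (Polynomial.aeval s f) < 1) →
      Algebra.trdeg k K = 3 →
      (∀ O₁ : ValuationSubring K, O < O₁ → O₁ = ⊤) →
      (∀ x : K, x ∈ O → ∃ m : ℕ, x ∈ tower O A m) →
      ¬ SingularPrimeThread O A →
      ∃ m : ℕ, IsRegularLocalRing ↥(tower O A m)) ↔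
    (PersistenceRadical → StrictDrop → ∀ p : ℕ, p.Prime → ∀ (k K : Type) [Field k] [CharP k p] [Field K]
      [Algebra k K] (O : ValuationSubring K) (A : Subalgebra k K), (∀ c : k, algebraMap k K c ∈ O) →
      A.FG → IsFractionRing ↥A K → A.toSubring ≤ O.toSubring →
      (∀ O' : ValuationSubring K,
        (∀ m : ℕ, ∀ s ∈ tower O A m, s ∈ O' ∧ (s⁻¹ ∈ O' → s⁻¹ ∈ O)) → ¬ IsNoetherianRing ↥O') →
      (∀ O' : ValuationSubring K, O < O' → ∃ m : ℕ, ∃ s ∈ tower O A m, s⁻¹ ∈ O' ∧ s⁻¹ ∉ O) →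
      (∀ (k' K' : Type) [Field k'] [CharP k' p] [Field K'] [Algebra k' K'] (O' : ValuationSubring K')
        (A' : Subalgebra k' K'), (∀ c : k', algebraMap k' K' c ∈ O') → A'.FG → IsFractionRing ↥A' K' →
        A'.toSubring ≤ O'.toSubring → Algebra.trdeg k' K' < Algebra.trdeg k K →
        ∃ m : ℕ, IsRegularLocalRing ↥(tower O' A' m)) →
      (∀ m : ℕ, ∀ s ∈ tower O A m, ∃ f : Polynomial k, f ≠ 0 ∧ O.valuation (Polynomial.aeval s f) < 1) →
      Algebra.trdeg k K = 3 →
      (∀ O₁ : ValuationSubring K, O < O₁ → O₁ = ⊤) →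
      (∀ x : K, x ∈ O → ∃ m : ℕ, x ∈ tower O A m) →
      ¬ SingularPrimeThread O A →
      False) := by
  constructor
  · intro h hP hD p hp k K _ _ _ _ O A hk hA hfr hAO hker hmax IH hzd htr hr1 hexh hthr
    exact no_regular_stage_of_exhaustive O A hk hA hfr hAO hker hexh
      (h hP hD p hp k K O A hk hA hfr hAO hker hmax IH hzd htr hr1 hexh hthr)
  · intro h hP hD p hp k K _ _ _ _ O A hk hA hfr hAO hker hmax IH hzd htr hr1 hexh hthr
    exact (h hP hD p hp k K O A hk hA hfr hAO hker hmax IH hzd htr hr1 hexh hthr).elim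

/-- **ExhHigh ⟺ «no datum meets ExhHigh's binders»** (the frontier-adjacent exhaustive half, tr.deg ≥ 4). [this work; iff-reading] -/
theorem exhHigh_iff_noDatum :
    (PersistenceRadical → StrictDrop → ∀ p : ℕ, p.Prime → ∀ (k K : Type) [Field k] [CharP k p] [Field K]
      [Algebra k K] (O : ValuationSubring K) (A : Subalgebra k K), (∀ c : k, algebraMap k K c ∈ O) →
      A.FG → IsFractionRing ↥A K → A.toSubring ≤ O.toSubring →
      (∀ O' : ValuationSubring K,
        (∀ m : ℕ, ∀ s ∈ tower O A m, s ∈ O' ∧ (s⁻¹ ∈ O' → s⁻¹ ∈ O)) → ¬ IsNoetherianRing ↥O') →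
      (∀ O' : ValuationSubring K, O < O' → ∃ m : ℕ, ∃ s ∈ tower O A m, s⁻¹ ∈ O' ∧ s⁻¹ ∉ O) →
      (∀ (k' K' : Type) [Field k'] [CharP k' p] [Field K'] [Algebra k' K'] (O' : ValuationSubring K')
        (A' : Subalgebra k' K'), (∀ c : k', algebraMap k' K' c ∈ O') → A'.FG → IsFractionRing ↥A' K' →
        A'.toSubring ≤ O'.toSubring → Algebra.trdeg k' K' < Algebra.trdeg k K →
        ∃ m : ℕ, IsRegularLocalRing ↥(tower O' A' m)) →
      (∀ m : ℕ, ∀ s ∈ tower O A m, ∃ f : Polynomial k, f ≠ 0 ∧ O.valuation (Polynomial.aeval s f) < 1) →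
      4 ≤ Algebra.trdeg k K →
      (∀ O₁ : ValuationSubring K, O < O₁ → O₁ = ⊤) →
      (∀ x : K, x ∈ O → ∃ m : ℕ, x ∈ tower O A m) →
      ¬ SingularPrimeThread O A →
      ∃ m : ℕ, IsRegularLocalRing ↥(tower O A m)) ↔
    (PersistenceRadical → StrictDrop → ∀ p : ℕ, p.Prime → ∀ (k K : Type) [Field k] [CharP k p] [Field K]
      [Algebra k K] (O : ValuationSubring K) (A : Subalgebra k K), (∀ c : k, algebraMap k K c ∈ O) →
      A.FG → IsFractionRing ↥A K → A.toSubring ≤ O.toSubring →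
      (∀ O' : ValuationSubring K,
        (∀ m : ℕ, ∀ s ∈ tower O A m, s ∈ O' ∧ (s⁻¹ ∈ O' → s⁻¹ ∈ O)) → ¬ IsNoetherianRing ↥O') →
      (∀ O' : ValuationSubring K, O < O' → ∃ m : ℕ, ∃ s ∈ tower O A m, s⁻¹ ∈ O' ∧ s⁻¹ ∉ O) →
      (∀ (k' K' : Type) [Field k'] [CharP k' p] [Field K'] [Algebra k' K'] (O' : ValuationSubring K')
        (A' : Subalgebra k' K'), (∀ c : k', algebraMap k' K' c ∈ O') → A'.FG → IsFractionRing ↥A' K' →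
        A'.toSubring ≤ O'.toSubring → Algebra.trdeg k' K' < Algebra.trdeg k K →
        ∃ m : ℕ, IsRegularLocalRing ↥(tower O' A' m)) →
      (∀ m : ℕ, ∀ s ∈ tower O A m, ∃ f : Polynomial k, f ≠ 0 ∧ O.valuation (Polynomial.aeval s f) < 1) →
      4 ≤ Algebra.trdeg k K →
      (∀ O₁ : ValuationSubring K, O < O₁ → O₁ = ⊤) →
      (∀ x : K, x ∈ O → ∃ m : ℕ, x ∈ tower O A m) →
      ¬ SingularPrimeThread O A →
      False) := by
  constructor
  · intro h hP hD p hp k K _ _ _ _ O A hk hA hfr hAO hker hmax IH hzd htr hr1 hexh hthr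
    exact no_regular_stage_of_exhaustive O A hk hA hfr hAO hker hexh
      (h hP hD p hp k K O A hk hA hfr hAO hker hmax IH hzd htr hr1 hexh hthr)
  · intro h hP hD p hp k K _ _ _ _ O A hk hA hfr hAO hker hmax IH hzd htr hr1 hexh hthr
    exact (h hP hD p hp k K O A hk hA hfr hAO hker hmax IH hzd htr hr1 hexh hthr).elim

/-- **E3 ⟺ «no datum meets E3's binders»**: E3's no-chain conclusion forces a regular stage (unit stage `CompositeSplit.exists_unitStage` +
`CompositeSplit.terminates_of_noChain`, using StrictDrop), which exhaustion excludes. [this work; iff-reading] -/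
theorem e3_iff_noDatum :
    (PersistenceRadical → StrictDrop → ∀ p : ℕ, p.Prime → ∀ (k K : Type) [Field k] [CharP k p] [Field K]
      [Algebra k K] (O : ValuationSubring K) (A : Subalgebra k K), (∀ c : k, algebraMap k K c ∈ O) →
      A.FG → IsFractionRing ↥A K → A.toSubring ≤ O.toSubring →
      (∀ O' : ValuationSubring K,
        (∀ m : ℕ, ∀ s ∈ tower O A m, s ∈ O' ∧ (s⁻¹ ∈ O' → s⁻¹ ∈ O)) → ¬ IsNoetherianRing ↥O') →
      (∀ O' : ValuationSubring K, O < O' → ∃ m : ℕ, ∃ s ∈ tower O A m, s⁻¹ ∈ O' ∧ s⁻¹ ∉ O) →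
      (∀ (k' K' : Type) [Field k'] [CharP k' p] [Field K'] [Algebra k' K'] (O' : ValuationSubring K')
        (A' : Subalgebra k' K'), (∀ c : k', algebraMap k' K' c ∈ O') → A'.FG → IsFractionRing ↥A' K' →
        A'.toSubring ≤ O'.toSubring → Algebra.trdeg k' K' < Algebra.trdeg k K →
        ∃ m : ℕ, IsRegularLocalRing ↥(tower O' A' m)) →
      (∀ m : ℕ, ∀ s ∈ tower O A m, ∃ f : Polynomial k, f ≠ 0 ∧ O.valuation (Polynomial.aeval s f) < 1) →
      Algebra.trdeg k K = 3 →
      (∃ O₁ : ValuationSubring K, O < O₁ ∧ O₁ ≠ ⊤) →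
      (∀ x : K, x ∈ O → ∃ m : ℕ, x ∈ tower O A m) →
      ¬ SingularPrimeThread O A →
      ∃ O₁ : ValuationSubring K, O < O₁ ∧ O₁ ≠ ⊤ ∧ ∃ m₀ : ℕ, ¬ ∃ z : ℕ → K,
        (∀ n : ℕ, (∃ m : ℕ, m₀ ≤ m ∧ z n ∈ ca (tower O A m)) ∧ z n ≠ 0 ∧ (z n)⁻¹ ∈ O₁) ∧
        (∀ n : ℕ, z n * (z (n + 1))⁻¹ ∈ O) ∧ ∀ n : ℕ, z (n + 1) * (z n)⁻¹ ∉ O) ↔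
    (PersistenceRadical → StrictDrop → ∀ p : ℕ, p.Prime → ∀ (k K : Type) [Field k] [CharP k p] [Field K]
      [Algebra k K] (O : ValuationSubring K) (A : Subalgebra k K), (∀ c : k, algebraMap k K c ∈ O) →
      A.FG → IsFractionRing ↥A K → A.toSubring ≤ O.toSubring →
      (∀ O' : ValuationSubring K,
        (∀ m : ℕ, ∀ s ∈ tower O A m, s ∈ O' ∧ (s⁻¹ ∈ O' → s⁻¹ ∈ O)) → ¬ IsNoetherianRing ↥O') →
      (∀ O' : ValuationSubring K, O < O' → ∃ m : ℕ, ∃ s ∈ tower O A m, s⁻¹ ∈ O' ∧ s⁻¹ ∉ O) →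
      (∀ (k' K' : Type) [Field k'] [CharP k' p] [Field K'] [Algebra k' K'] (O' : ValuationSubring K')
        (A' : Subalgebra k' K'), (∀ c : k', algebraMap k' K' c ∈ O') → A'.FG → IsFractionRing ↥A' K' →
        A'.toSubring ≤ O'.toSubring → Algebra.trdeg k' K' < Algebra.trdeg k K →
        ∃ m : ℕ, IsRegularLocalRing ↥(tower O' A' m)) →
      (∀ m : ℕ, ∀ s ∈ tower O A m, ∃ f : Polynomial k, f ≠ 0 ∧ O.valuation (Polynomial.aeval s f) < 1) →
      Algebra.trdeg k K = 3 →
      (∃ O₁ : ValuationSubring K, O < O₁ ∧ O₁ ≠ ⊤) →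
      (∀ x : K, x ∈ O → ∃ m : ℕ, x ∈ tower O A m) →
      ¬ SingularPrimeThread O A →
      False) := by
  constructor
  · intro h hP hD p hp k K _ _ _ _ O A hk hA hfr hAO hker hmax IH hzd htr hO₁ hexh hthr
    obtain ⟨O₁, h₁, -, m₀, hno⟩ := h hP hD p hp k K O A hk hA hfr hAO hker hmax IH hzd htr hO₁ hexh hthr
    obtain ⟨n₁, hc⟩ := CompositeSplit.exists_unitStage hP hD p hp k K O A hk hA hfr hAO hmax hthr O₁ h₁
    exact no_regular_stage_of_exhaustive O A hk hA hfr hAO hker hexh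
      (CompositeSplit.terminates_of_noChain hP hD p hp k K O A hk hA hfr hAO O₁ h₁.le hc m₀ hno)
  · intro h hP hD p hp k K _ _ _ _ O A hk hA hfr hAO hker hmax IH hzd htr hO₁ hexh hthr
    exact (h hP hD p hp k K O A hk hA hfr hAO hker hmax IH hzd htr hO₁ hexh hthr).elim

/-- **ShadowCapture3 ⟺ «no datum meets its binders»** (shadow capture kills chains, `CompositeSplit.noChain_of_shadowCapture`; no chain forces
a regular stage; exhaustion excludes it). [this work; iff-reading] -/
theorem shadowCapture3_iff_noDatum :
    (PersistenceRadical → StrictDrop → ∀ p : ℕ, p.Prime → ∀ (k K : Type) [Field k] [CharP k p] [Field K]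
      [Algebra k K] (O : ValuationSubring K) (A : Subalgebra k K) (hk : ∀ c : k, algebraMap k K c ∈ O),
      A.FG → IsFractionRing ↥A K → A.toSubring ≤ O.toSubring →
      (∀ O' : ValuationSubring K,
        (∀ m : ℕ, ∀ s ∈ tower O A m, s ∈ O' ∧ (s⁻¹ ∈ O' → s⁻¹ ∈ O)) → ¬ IsNoetherianRing ↥O') →
      (∀ O' : ValuationSubring K, O < O' → ∃ m : ℕ, ∃ s ∈ tower O A m, s⁻¹ ∈ O' ∧ s⁻¹ ∉ O) →
      (∀ (k' K' : Type) [Field k'] [CharP k' p] [Field K'] [Algebra k' K'] (O' : ValuationSubring K')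
        (A' : Subalgebra k' K'), (∀ c : k', algebraMap k' K' c ∈ O') → A'.FG → IsFractionRing ↥A' K' →
        A'.toSubring ≤ O'.toSubring → Algebra.trdeg k' K' < Algebra.trdeg k K →
        ∃ m : ℕ, IsRegularLocalRing ↥(tower O' A' m)) →
      (∀ m : ℕ, ∀ s ∈ tower O A m, ∃ f : Polynomial k, f ≠ 0 ∧ O.valuation (Polynomial.aeval s f) < 1) →
      Algebra.trdeg k K = 3 →
      (∃ O₁ : ValuationSubring K, O < O₁ ∧ O₁ ≠ ⊤) →
      (∀ U : ValuationSubring K, O < U → ∃ z : ℕ → K, (∀ n : ℕ, z n ∈ O ∧ z n ≠ 0 ∧ (z n)⁻¹ ∈ U) ∧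
        (∀ n : ℕ, z n * (z (n + 1))⁻¹ ∈ O) ∧ ∀ n : ℕ, z (n + 1) * (z n)⁻¹ ∉ O) →
      (∀ (O₁ : ValuationSubring K) (h₁ : O < O₁), O₁ ≠ ⊤ →
        IsDiscreteValuationRing ↥O₁ ∧ residueTrdeg k O₁ (fun c => h₁.le (hk c)) = 2 ∧
        ∃ m : ℕ, ∀ M : ℕ, m ≤ M → (loc O₁ (tower O A M)).toSubring = O₁.toSubring) →
      (∀ x : K, x ∈ O → ∃ m : ℕ, x ∈ tower O A m) →
      ¬ SingularPrimeThread O A →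
      ∃ (O₁ : ValuationSubring K) (h₁ : O < O₁), O₁ ≠ ⊤ ∧ ∃ Nb : Subring (ResidueField ↥O₁),
        IsNoetherianRing ↥Nb ∧ Nb ≤ (residueValuationSubring O O₁ h₁.le).toSubring ∧
        ∃ m₀ : ℕ, ∀ M : ℕ, m₀ ≤ M → ∀ a ∈ ca (tower O A M), ∃ h : a ∈ O₁, residue ↥O₁ ⟨a, h⟩ ∈ Nb) ↔
    (PersistenceRadical → StrictDrop → ∀ p : ℕ, p.Prime → ∀ (k K : Type) [Field k] [CharP k p] [Field K]
      [Algebra k K] (O : ValuationSubring K) (A : Subalgebra k K) (hk : ∀ c : k, algebraMap k K c ∈ O),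
      A.FG → IsFractionRing ↥A K → A.toSubring ≤ O.toSubring →
      (∀ O' : ValuationSubring K,
        (∀ m : ℕ, ∀ s ∈ tower O A m, s ∈ O' ∧ (s⁻¹ ∈ O' → s⁻¹ ∈ O)) → ¬ IsNoetherianRing ↥O') →
      (∀ O' : ValuationSubring K, O < O' → ∃ m : ℕ, ∃ s ∈ tower O A m, s⁻¹ ∈ O' ∧ s⁻¹ ∉ O) →
      (∀ (k' K' : Type) [Field k'] [CharP k' p] [Field K'] [Algebra k' K'] (O' : ValuationSubring K')
        (A' : Subalgebra k' K'), (∀ c : k', algebraMap k' K' c ∈ O') → A'.FG → IsFractionRing ↥A' K' →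
        A'.toSubring ≤ O'.toSubring → Algebra.trdeg k' K' < Algebra.trdeg k K →
        ∃ m : ℕ, IsRegularLocalRing ↥(tower O' A' m)) →
      (∀ m : ℕ, ∀ s ∈ tower O A m, ∃ f : Polynomial k, f ≠ 0 ∧ O.valuation (Polynomial.aeval s f) < 1) →
      Algebra.trdeg k K = 3 →
      (∃ O₁ : ValuationSubring K, O < O₁ ∧ O₁ ≠ ⊤) →
      (∀ U : ValuationSubring K, O < U → ∃ z : ℕ → K, (∀ n : ℕ, z n ∈ O ∧ z n ≠ 0 ∧ (z n)⁻¹ ∈ U) ∧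
        (∀ n : ℕ, z n * (z (n + 1))⁻¹ ∈ O) ∧ ∀ n : ℕ, z (n + 1) * (z n)⁻¹ ∉ O) →
      (∀ (O₁ : ValuationSubring K) (h₁ : O < O₁), O₁ ≠ ⊤ →
        IsDiscreteValuationRing ↥O₁ ∧ residueTrdeg k O₁ (fun c => h₁.le (hk c)) = 2 ∧
        ∃ m : ℕ, ∀ M : ℕ, m ≤ M → (loc O₁ (tower O A M)).toSubring = O₁.toSubring) →
      (∀ x : K, x ∈ O → ∃ m : ℕ, x ∈ tower O A m) →
      ¬ SingularPrimeThread O A →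
      False) := by
  constructor
  · intro h hP hD p hp k K _ _ _ _ O A hk hA hfr hAO hker hmax IH hzd htr hO₁ hnd hpd hexh hthr
    obtain ⟨O₁, h₁, -, Nb, hN, hNO, m₀, hcap⟩ := h hP hD p hp k K O A hk hA hfr hAO hker hmax IH hzd htr hO₁ hnd hpd hexh hthr
    have hno := CompositeSplit.noChain_of_shadowCapture O O₁ h₁.le A (fun m s hs => TraceSocle.stage_le O A hk hAO m s hs)
      Nb hN hNO m₀ hcap
    obtain ⟨n₁, hc⟩ := CompositeSplit.exists_unitStage hP hD p hp k K O A hk hA hfr hAO hmax hthr O₁ h₁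
    exact no_regular_stage_of_exhaustive O A hk hA hfr hAO hker hexh
      (CompositeSplit.terminates_of_noChain hP hD p hp k K O A hk hA hfr hAO O₁ h₁.le hc m₀ hno)
  · intro h hP hD p hp k K _ _ _ _ O A hk hA hfr hAO hker hmax IH hzd htr hO₁ hnd hpd hexh hthr
    exact (h hP hD p hp k K O A hk hA hfr hAO hker hmax IH hzd htr hO₁ hnd hpd hexh hthr).elim

end Summit.ResolutionOfSingularities.ResolutionOfSingularities.Theorems.NoZeno.Exhaustion

end
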